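import Summits.QuantumFields.QCD.Theses.SpectralDefectExtinction
import Literature.MathematicalPhysics.QuantumLattice.OverlapLocality

/-!
# Stub `stub_perturbation` of line `positivity-no-leak-spread`
(crux `SpectralDefectExtinction.TipNoBinding`, item stmt-QuantumFields-8965)

The perturbation `B = D_W(U,0,1) − D_W(1,0,1)` of the massless `r = 1` Wilson–Dirac operator by an
`SU(3)` gauge field `U` that is trivial on every link based outside the image `P` of the box
`{−R..R}⁴` in the torus `(ℤ/L)⁴` is LOCAL and BOUNDED:

* with `S := P ∪ ⋃_μ (P + μ̂)` (at most `5(2R+1)⁴` sites) every matrix entry `B (p, q)` with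
  `p.1 ∉ S` or `q.1 ∉ S` vanishes, because such an entry only involves links `(z, μ)` one of whose
  endpoints `z`, `z + μ̂` lies outside `S`, and such a link is based outside `P`, hence trivial;
* consequently `(Bψ)(y) = 0` off `S` (row support) and `Bψ = B(1_S ψ)` (column support), so the
  operator-norm bound `‖B‖ ≤ ‖D_W(U)‖ + ‖D_W(1)‖ ≤ 8 + 8` (HJL (2.14), the tree's
  `l2_opNorm_wilsonDirac_le`) gives `Σ_i ‖(Bψ)_i‖² ≤ 256 Σ_{x ∈ S} |ψ(x)|²`.

No new definitions; pure theorem file serving the lead's skeleton `work/TipNoBinding.lean`.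
-/

namespace Summit.QuantumFields.QCD.Cruxes.TipNoBinding.PositivityNoLeakSpread

open Literature.MathematicalPhysics Literature.MathematicalPhysics.QuantumLattice
  Literature.MathematicalPhysics.QuantumFieldTheory Literature.Probability.LatticeModels
open Matrix

/-- **Entries of the perturbation vanish off `S × S`.**  If every link `(z, μ)` with `z ∉ S` or
`z + μ̂ ∉ S` carries the trivial group element, then the `(p, q)` entry of
`D_W(U,0,1) − D_W(1,0,1)` is zero as soon as `p.1 ∉ S` or `q.1 ∉ S`: the diagonal terms cancel,
the forward hopping term lives on the link `(p.1, μ)` with `q.1 = p.1 + μ̂`, the backward one on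
the link `(q.1, μ)` with `p.1 = q.1 + μ̂`, and both links are trivial. -/
private theorem pert_apply_eq_zero {L : ℕ} [NeZero L]
    (U : GaugeConfig 4 L ↥(Matrix.specialUnitaryGroup (Fin 3) ℂ)) (S : Finset (TorusSite 4 L))
    (hlink : ∀ (z : TorusSite 4 L) (μ : Fin 4),
      (z ∉ S ∨ QuantumFieldTheory.Site.shift z μ ∉ S) → U (z, μ) = 1)
    (p q : TorusSite 4 L × Fin 3 × Fin 4) (hpq : p.1 ∉ S ∨ q.1 ∉ S) :
    (wilsonDirac (fundamentalRep (Fin 3)) U 0 1 -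
      wilsonDirac (fundamentalRep (Fin 3))
        (1 : GaugeConfig 4 L ↥(Matrix.specialUnitaryGroup (Fin 3) ℂ)) 0 1) p q = 0 := by
  rw [Matrix.sub_apply, sub_eq_zero]
  simp only [wilsonDirac, Matrix.of_apply]
  congr 1
  congr 1
  refine Finset.sum_congr rfl fun μ _ => ?_
  congr 1
  · by_cases h : q.1 = QuantumFieldTheory.Site.shift p.1 μ
    · have h1 : U (p.1, μ) = 1 := by
        refine hlink p.1 μ ?_
        rcases hpq with hp | hq
        · exact Or.inl hp
        · rw [h] at hq
          exact Or.inr hq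
      rw [if_pos h, if_pos h, h1]
      rfl
    · rw [if_neg h, if_neg h]
  · by_cases h : p.1 = QuantumFieldTheory.Site.shift q.1 μ
    · have h1 : U (q.1, μ) = 1 := by
        refine hlink q.1 μ ?_
        rcases hpq with hp | hq
        · rw [h] at hp
          exact Or.inr hp
        · exact Or.inl hq
      rw [if_pos h, if_pos h, h1]
      rfl
    · rw [if_neg h, if_neg h]

/-- `Σ_i ‖(1_S ψ)_i‖² = Σ_{x ∈ S} Σ_{a, α} ‖ψ(x, a, α)‖²`: the `ℓ²` mass of the restriction of
`ψ` to the sites of `S`. -/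
private theorem sum_norm_sq_restrict {L : ℕ} [NeZero L] (S : Finset (TorusSite 4 L))
    (ψ : TorusSite 4 L × Fin 3 × Fin 4 → ℂ) :
    ∑ i : TorusSite 4 L × Fin 3 × Fin 4, ‖(if i.1 ∈ S then ψ i else 0)‖ ^ 2 =
      ∑ x ∈ S, ∑ a, ∑ α, ‖ψ (x, a, α)‖ ^ 2 := by
  rw [Fintype.sum_prod_type, ← Fintype.sum_extend_by_zero S]
  refine Finset.sum_congr rfl fun x _ => ?_
  by_cases hx : x ∈ S
  · simp only [hx, if_true, Fintype.sum_prod_type]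
  · simp [hx]

section OperatorNorm

open scoped Matrix.Norms.L2Operator

/-- **The perturbation is bounded**: `Σ_i ‖(Bφ)_i‖² ≤ 256 Σ_i ‖φ_i‖²` for
`B = D_W(U,0,1) − D_W(1,0,1)`, from `‖B‖ ≤ ‖D_W(U,0,1)‖ + ‖D_W(1,0,1)‖ ≤ (|0 + 4| + 4) + (|0 + 4| + 4)
= 16` (the tree's `l2_opNorm_wilsonDirac_le`, HJL (2.14), for the unitary fundamental
representation) and the quadratic-form version of the operator norm (`sum_norm_sq_mulVec_le`). -/
private theorem sum_norm_sq_pert_mulVec_le {L : ℕ} [NeZero L]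
    (U : GaugeConfig 4 L ↥(Matrix.specialUnitaryGroup (Fin 3) ℂ))
    (φ : TorusSite 4 L × Fin 3 × Fin 4 → ℂ) :
    ∑ i, ‖((wilsonDirac (fundamentalRep (Fin 3)) U 0 1 -
        wilsonDirac (fundamentalRep (Fin 3))
          (1 : GaugeConfig 4 L ↥(Matrix.specialUnitaryGroup (Fin 3) ℂ)) 0 1) *ᵥ φ) i‖ ^ 2 ≤
      256 * ∑ i, ‖φ i‖ ^ 2 := by
  set B := wilsonDirac (fundamentalRep (Fin 3)) U 0 1 -
    wilsonDirac (fundamentalRep (Fin 3))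
      (1 : GaugeConfig 4 L ↥(Matrix.specialUnitaryGroup (Fin 3) ℂ)) 0 1 with hB
  have hρ : ∀ g, fundamentalRep (Fin 3) g ∈ Matrix.unitaryGroup (Fin 3) ℂ :=
    fundamentalRep_mem_unitaryGroup
  have h1 := l2_opNorm_wilsonDirac_le (fundamentalRep (Fin 3)) hρ U 0
  have h2 := l2_opNorm_wilsonDirac_le (fundamentalRep (Fin 3)) hρ
    (1 : GaugeConfig 4 L ↥(Matrix.specialUnitaryGroup (Fin 3) ℂ)) 0
  have h8 : |(0 : ℝ) + 4| + 4 = 8 := by norm_num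
  rw [h8] at h1 h2
  have hBn : ‖B‖ ≤ 16 := by
    rw [hB]
    exact (norm_sub_le _ _).trans (by linarith)
  refine (sum_norm_sq_mulVec_le B φ).trans ?_
  have h0 : 0 ≤ ∑ i, ‖φ i‖ ^ 2 := Finset.sum_nonneg fun i _ => by positivity
  have h256 : ‖B‖ ^ 2 ≤ 256 := by nlinarith [norm_nonneg B]
  exact mul_le_mul_of_nonneg_right h256 h0

end OperatorNorm

/-- **PERTURBATION is local and bounded** (stub `stub_perturbation` of the lead's skeleton, proved):
for an `SU(3)` field trivial on every link based outside the image `P` of the box `{−R..R}⁴`, the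
perturbation `B = D_W(U,0,1) − D_W(1,0,1)` is supported, in rows and columns, on the site set
`S = P ∪ ⋃_μ (P + μ̂)` with `|S| ≤ 5(2R+1)⁴` (`card_box`, `Finset.card_image_le`,
`Finset.card_biUnion_le`), so `(Bψ)(y) = 0` for `y ∉ S` and
`Σ_i ‖(Bψ)_i‖² = Σ_i ‖(B(1_Sψ))_i‖² ≤ ‖B‖² ‖1_Sψ‖² ≤ 256 Σ_{x ∈ S} |ψ(x)|²`. -/
theorem stub_perturbation :
    ∀ (R L : ℕ) [NeZero L] (U : GaugeConfig 4 L ↥(Matrix.specialUnitaryGroup (Fin 3) ℂ)),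
      (∀ (x : TorusSite 4 L) (μ : Fin 4), (∀ y ∈ box 4 R, Torus.proj L y ≠ x) → U (x, μ) = 1) →
      ∃ S : Finset (TorusSite 4 L), S.card ≤ 5 * (2 * R + 1) ^ 4 ∧
        ∀ ψ : TorusSite 4 L × Fin 3 × Fin 4 → ℂ,
          (∀ i : TorusSite 4 L × Fin 3 × Fin 4, i.1 ∉ S →
            ((wilsonDirac (fundamentalRep (Fin 3)) U 0 1 -
                wilsonDirac (fundamentalRep (Fin 3))
                  (1 : GaugeConfig 4 L ↥(Matrix.specialUnitaryGroup (Fin 3) ℂ)) 0 1) *ᵥ ψ) i = 0) ∧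
          ∑ i, ‖((wilsonDirac (fundamentalRep (Fin 3)) U 0 1 -
                wilsonDirac (fundamentalRep (Fin 3))
                  (1 : GaugeConfig 4 L ↥(Matrix.specialUnitaryGroup (Fin 3) ℂ)) 0 1) *ᵥ ψ) i‖ ^ 2 ≤
            256 * ∑ x ∈ S, ∑ a, ∑ α, ‖ψ (x, a, α)‖ ^ 2 := by
  intro R L _ U hU
  -- the box image `P` and the support set `S = P ∪ ⋃_μ (P + μ̂)`
  obtain ⟨P, hP⟩ : ∃ P : Finset (TorusSite 4 L), P = (box 4 R).image (Torus.proj L) := ⟨_, rfl⟩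
  obtain ⟨S, hS⟩ : ∃ S : Finset (TorusSite 4 L), S = P ∪ (Finset.univ : Finset (Fin 4)).biUnion
      (fun μ => P.image fun x : TorusSite 4 L =>
        (QuantumFieldTheory.Site.shift x μ : TorusSite 4 L)) := ⟨_, rfl⟩
  -- links based outside `P` are trivial
  have hPU : ∀ z : TorusSite 4 L, z ∉ P → ∀ μ : Fin 4, U (z, μ) = 1 := by
    intro z hz μ
    refine hU z μ fun y hy hyz => hz ?_
    rw [hP, Finset.mem_image]
    exact ⟨y, hy, hyz⟩
  -- a link with an endpoint outside `S` is trivial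
  have hlink : ∀ (z : TorusSite 4 L) (μ : Fin 4),
      (z ∉ S ∨ QuantumFieldTheory.Site.shift z μ ∉ S) → U (z, μ) = 1 := by
    intro z μ h
    by_contra hne
    have hzP : z ∈ P := by
      by_contra hzP
      exact hne (hPU z hzP μ)
    rcases h with h | h
    · exact h (hS ▸ Finset.mem_union_left _ hzP)
    · refine h (hS ▸ Finset.mem_union_right _ ?_)
      rw [Finset.mem_biUnion]
      exact ⟨μ, Finset.mem_univ _, Finset.mem_image.mpr ⟨z, hzP, rfl⟩⟩
  refine ⟨S, ?_, fun ψ => ⟨fun i hi => ?_, ?_⟩⟩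
  · -- `|S| ≤ |P| + 4|P| ≤ 5(2R+1)⁴`
    have hPc : P.card ≤ (2 * R + 1) ^ 4 := by
      rw [hP, ← card_box 4 R]
      exact Finset.card_image_le
    calc S.card ≤ P.card + ((Finset.univ : Finset (Fin 4)).biUnion
          (fun μ => P.image fun x : TorusSite 4 L =>
            (QuantumFieldTheory.Site.shift x μ : TorusSite 4 L))).card := by
          rw [hS]
          exact Finset.card_union_le _ _
      _ ≤ P.card + ∑ μ : Fin 4, (P.image fun x : TorusSite 4 L =>
            (QuantumFieldTheory.Site.shift x μ : TorusSite 4 L)).card :=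
          Nat.add_le_add_left Finset.card_biUnion_le _
      _ ≤ P.card + ∑ _μ : Fin 4, P.card :=
          Nat.add_le_add_left (Finset.sum_le_sum fun μ _ => Finset.card_image_le) _
      _ ≤ 5 * (2 * R + 1) ^ 4 := by
          simp only [Finset.sum_const, Finset.card_univ, Fintype.card_fin, smul_eq_mul]
          omega
  · -- row support: `(Bψ) i = Σ_j B i j ψ j = 0` for `i.1 ∉ S`
    simp only [Matrix.mulVec, dotProduct]
    exact Finset.sum_eq_zero fun j _ =>
      mul_eq_zero_of_left (pert_apply_eq_zero U S hlink i j (Or.inl hi)) _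
  · -- column support + operator norm
    have hcol : (wilsonDirac (fundamentalRep (Fin 3)) U 0 1 -
          wilsonDirac (fundamentalRep (Fin 3))
            (1 : GaugeConfig 4 L ↥(Matrix.specialUnitaryGroup (Fin 3) ℂ)) 0 1) *ᵥ ψ =
        (wilsonDirac (fundamentalRep (Fin 3)) U 0 1 -
          wilsonDirac (fundamentalRep (Fin 3))
            (1 : GaugeConfig 4 L ↥(Matrix.specialUnitaryGroup (Fin 3) ℂ)) 0 1) *ᵥ
          (fun q => if q.1 ∈ S then ψ q else 0) := by
      funext p
      simp only [Matrix.mulVec, dotProduct]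
      refine Finset.sum_congr rfl fun q _ => ?_
      by_cases hq : q.1 ∈ S
      · rw [if_pos hq]
      · rw [if_neg hq, pert_apply_eq_zero U S hlink p q (Or.inr hq), zero_mul, zero_mul]
    rw [hcol, ← sum_norm_sq_restrict S ψ]
    exact sum_norm_sq_pert_mulVec_le U _

end Summit.QuantumFields.QCD.Cruxes.TipNoBinding.PositivityNoLeakSpread
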